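import Literature.MathematicalPhysics.QuantumFieldTheory.Balaban1983to89.B9Eq3132TentHull
import Literature.MathematicalPhysics.QuantumFieldTheory.Balaban1983to89.B9Eq340TaxiRungs

/-!
# `Balaban1983to89.B9Eq3132TentLassos` — T. Bałaban, *Propagators for lattice gauge theories in a background field*, Commun. Math. Phys. **99** (1985) 389–434
# [Balaban1985BackgroundPropagators], (3.35) p. 396, (3.40) p. 397, (3.69) p. 404, (3.132) p. 422 with [Balaban1984PropagatorsII] (2.147) p. 248: THE TAXICAB LASSOS ON
# THE BASE BLOCKS ARE SMALL FOR EVERY (3.35)-REGULAR BACKGROUND (`|U(Γ_{x₀,z})U(z,z+e_κ)U(Γ_{x₀,z+e_κ})⁻¹ − 1| ≤ 2(d+1)L²ϖ(cMα₀)·(Lʲ)⁻¹`), HENCE ROW 26's LAST BINDER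
# `hP1` — THE `Δ_a(U)`-ENERGY OF THE TRANSPORTED TENT BUMPS — HOLDS UNCONDITIONALLY AT def-Y's LETTERS

statement-level skeleton of published theorems with citation tags; proofs where landed; nothing here is a claim about the Yang–Mills mass gap

THE PRINT.  [B9] p. 397 (3.40) (Hölder norms with transport along shortest contours), p. 396 (3.35), p. 404 («the estimates follow directly from the assumptions (3.35)»),
p. 422 (3.132) («as in [4] (2.147)»); [4] p. 248 (2.147) (the energy of the tent test functions).

WHY THIS FILE (dag-n06-i gen 14, N06 bundle F4, row 26) — THE LAST STEP OF THE (P′1) ROADMAP.  `B9Eq3132TentPlaquettes.hP1_of_lassoSmall` reduced the certificate's `hP1` to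
the member-uniform smallness of the base-block taxicab lassos.  Here: the lasso is a conjugate of the signed lasso of the later legs (`B9Eq340TaxiLasso`), bounded by the
defects of the plaquettes it sweeps (`B9Eq340StepLasso`); those plaquettes have all corners coordinatewise on the shorter arcs from the origin (block centre) to the target
(`B9Eq340TaxiRungs`), hence in the hull box (`B9Eq3132TentHull`), which lies in ONE class cube of index `≥ j − 1`; so each of the `≤ (d+1)·2Lʲ` swept plaquettes is within
`ϖ(cMα₀)·L²·(Lʲ)⁻²` of `1` by n06-j's (3.35) ⇒ (3.69) estimate.  The no-antipode hypothesis of the `κ`-leg is discharged by `4Lʲ < period`.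

WHAT IS PROVED (sorry-free, 0 def).
* §1 `fwd_count_lt` ∕ `min_count_lt` (shorter counts inside a short interval), `legPt_apply` (the `κ`-leg endpoint's coordinates), `norm_plaqU_sub_one_le_of_mem`
  (n06-j's bound for either orientation), ★★★ `lassoSmall_of_reg335` (KIdx level, any `G ≤ U(N)`, `N ≥ 1`).
* §2 `baseLassoSmall_of_isEmpty`, ★★★ `lassoSmall_member_of_reg335`, ★★★ `hP1_of_reg335 θ Mstar` — THE CERTIFICATE's `hP1` (shape of
  `B9Eq3132CoerciveFromEnergy.hco26_of_energy_step12`, VERBATIM) with NO displayed hypothesis.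

HONEST SCOPE.  Lattice∕linear-algebra bookkeeping over def-Y's letters, the tree's [4] machinery and n06-j's (3.35) estimate; `hP1` is an elementary estimate about def-Y's
OWN test family — its discharge removes a displayed binder of the N06 certificate, it asserts nothing of [B9] beyond the cited dictionary and does NOT discharge N06 (rows
17, 20, … keep their displayed printed hypotheses); count-neutral.  Cell `pub-ymgap` (HUMAN RULING D-0062), Track A node N06 [B9], seat `pub-ymgap-dag-n06-i` (gen 14),
2026-08-27; a NEW file.
-/

noncomputable section

namespace Literature.MathematicalPhysics.QuantumFieldTheory.Balaban1983to89.B9Eq3132TentLassos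

open Node00
open B6KLevelCensusIndexV1 (KIdx kGeo)
open B6GlobalChartV1 (PV domT toBox)
open B6Ineq2142KLevelV1 (lvl base)
open B5Eq118OneStroke (iterBlock mem_iterBlock mem_iterBlock_iff)
open B9BackgroundsKLevelV1 (bg9K cubeClass396 levV1 torusCube shiftsV1)
open B9Eq39Adjoint (plaqU)
open T4RelativeLadder (UnitaryLike)
open B9Eq3132TentBumps (baseBlk orgY sideY sideY_pos)
open B9Eq3132EnergyOfTents (BaseLassoSmall BasePlaqSmall)
open B9Eq3132TentPlaquettes (varpi varpi_nonneg varpi_mono reg335_const_pos M_pos)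
open B9Eq3132TentHull (cornerOf hullSide hullBox hullSide_le orgY_mem_hullBox baseBlk_subset_hullBox four_mul_side_lt two_mul_hullSide_le exists_cubeClass396_hullBox)
open B9Eq340StepLasso (stepDefect legSteps taxiSteps rungSites stepDefect_le_of_forall stepEnd_legSteps_apply_of_ne)
open B9Eq340TaxiLasso (legPt preState split_nodup norm_taxiLasso_sub_one_le val_sub_add_val_sub)
open B9Eq340TaxiRungs (OnArc onArc_mem_interval val_add_cases rungSites_taxiSteps stepEnd_legSteps_apply_self length_taxiSteps_le)
open B9PinMembersKLevelV1 (MemberY geo9Y bg9Y)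
open B7Prop2SpecialUnitary (specialUnitaryUnits specialUnitaryUnits_le_unitaryUnits)
open scoped Matrix Matrix.Norms.L2Operator

variable {N : ℕ} {d ℓ : ℕ} {hd : 1 ≤ d + 1} {hL : Odd (ℓ + 1) ∧ 1 < ℓ + 1} {b₀ b₁ : ℝ} (i : KIdx d ℓ hd hL b₀ b₁)

/-! ## §1 The base-block lassos at a k-level index -/

section Counts

variable {n : ℕ} [NeZero n]

/-- ★ **THE FORWARD COUNT INSIDE AN INTERVAL**: `c, t` in `{u | (u − c₀).val < s}`, forward regime at `t` ⇒ `(t − c).val < s` (the other way round is even longer).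
[cite: Balaban1985BackgroundPropagators, (3.40) p.397, (3.1) p.390, bookkeeping] -/
theorem fwd_count_lt {c₀ c t : ZMod n} {s : ℕ} (hc : (c - c₀).val < s) (ht : (t - c₀).val < s) (hreg : (t - c).val ≤ (c - t).val) :
    (t - c).val < s := by
  by_cases hct : t = c
  · subst hct; rw [sub_self, ZMod.val_zero]; omega
  have hsum := val_sub_add_val_sub hct
  have key := val_add_cases (t - c) (c - c₀)
  rw [show t - c + (c - c₀) = t - c₀ by ring] at key
  rcases key with ⟨h1, _⟩ | ⟨h1, _⟩ <;> omega

/-- the shorter count inside an interval of length `s` is `< s`. [cite: Balaban1985BackgroundPropagators, (3.40) p.397, bookkeeping] -/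
theorem min_count_lt {c₀ c t : ZMod n} {s : ℕ} (hc : (c - c₀).val < s) (ht : (t - c₀).val < s) :
    min (t - c).val (c - t).val < s := by
  rcases le_total (t - c).val (c - t).val with h | h
  · exact lt_of_le_of_lt (min_le_left _ _) (fwd_count_lt hc ht h)
  · exact lt_of_le_of_lt (min_le_right _ _) (fwd_count_lt ht hc h)

end Counts

/-- the `κ`-leg endpoint agrees with the origin in the later directions … [cite: Balaban1985BackgroundPropagators, (3.40) p.397, bookkeeping] -/
theorem legPt_apply {𝔸 : Type} [NormedRing 𝔸] [NormedAlgebra ℂ 𝔸] [CompleteSpace 𝔸] (U : CfgY 𝔸 i) (x z : Site (PV d ℓ i.m i.K hd hL) 0) (κ : Fin (PV d ℓ i.m i.K hd hL).d)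
    {l₁ l₂ : List (Fin (PV d ℓ i.m i.K hd hL).d)} (hl : List.finRange (PV d ℓ i.m i.K hd hL).d = l₁ ++ κ :: l₂) (μ : Fin (PV d ℓ i.m i.K hd hL).d) :
    legPt U x z κ l₁ μ = if μ ∈ l₂ then x μ else z μ := by
  obtain ⟨_, hκ1, _, hκ2⟩ := split_nodup hl
  have hnd : (l₁ ++ κ :: l₂).Nodup := hl ▸ List.nodup_finRange _
  have hw : ∀ ν, (preState U x z l₁).1 ν = if ν ∈ l₁ then z ν else x ν := fun ν => Node00.taxiRun_fst_apply U z l₁ (x, 1) ν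
  unfold legPt
  by_cases hμκ : μ = κ
  · subst hμκ
    rw [stepEnd_legSteps_apply_self μ (by rw [hw, if_neg hκ1]), if_neg hκ2]
  · rw [stepEnd_legSteps_apply_of_ne κ _ _ _ hμκ, hw]
    have hmem : μ ∈ l₁ ++ κ :: l₂ := hl ▸ List.mem_finRange μ
    rw [List.mem_append, List.mem_cons] at hmem
    by_cases h2 : μ ∈ l₂
    · rw [if_pos h2, if_neg (fun h1 => (List.nodup_append.1 hnd).2.2 μ h1 μ (List.mem_cons_of_mem _ h2) rfl)]
    · rw [if_neg h2]
      rcases hmem with h | h | h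
      · rw [if_pos h]
      · exact absurd h hμκ
      · exact absurd h h2

/-- ★ **THE (3.35) PLAQUETTE BOUND IN EITHER ORIENTATION**: three corners in a class cube `(□, j′)` ⇒ `‖U(∂p) − 1‖ ≤ ϖ(cMα₀)·(L^{j′})⁻²`.
[cite: Balaban1985BackgroundPropagators, (3.35) p.396, (3.69) p.404] -/
theorem norm_plaqU_sub_one_le_of_mem [Nonempty (Fin N)] {G : Subgroup (Matrix (Fin N) (Fin N) ℂ)ˣ} (hG : G ≤ B7Prop2Explicit.unitaryUnits (Matrix (Fin N) (Fin N) ℂ))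
    {U : CfgY (Matrix (Fin N) (Fin N) ℂ) i} {c α₀ : ℝ} (h : (bg9K (Matrix (Fin N) (Fin N) ℂ) G i).Reg335 c α₀ U)
    {q : Set (Site (PV d ℓ i.m i.K hd hL) 0) × ℕ} (hq : q ∈ cubeClass396 i) {μ₁ μ₂ : Fin (PV d ℓ i.m i.K hd hL).d} (hne : μ₁ ≠ μ₂)
    {v : Site (PV d ℓ i.m i.K hd hL) 0} (hv : v ∈ q.1) (h1 : v.shift μ₁ ∈ q.1) (h2 : v.shift μ₂ ∈ q.1) :
    ‖((plaqU (shiftsV1 (PV d ℓ i.m i.K hd hL)) U μ₁ μ₂ v : (Matrix (Fin N) (Fin N) ℂ)ˣ) : Matrix (Fin N) (Fin N) ℂ) - 1‖ ≤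
      varpi (c * (kGeo i).M * α₀) * ((((ℓ + 1 : ℕ) : ℝ)) ^ q.2)⁻¹ ^ 2 := by
  have hC := (reg335_const_pos i h).le
  have hUu : ∀ μ x, ((U μ x : (Matrix (Fin N) (Fin N) ℂ)ˣ) : Matrix (Fin N) (Fin N) ℂ) ∈ unitary (Matrix (Fin N) (Fin N) ℂ) := fun μ x => hG (h.1 μ x)
  rcases lt_or_gt_of_ne hne with hlt | hlt
  · have key := B9Eq335PlaquetteAtLettersY.norm_holY_sub_one_le_of_reg335 i U hC h hq ⟨v, μ₁, μ₂, hlt⟩ hv h1 h2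
    exact key
  · have key := B9Eq335PlaquetteAtLettersY.norm_holY_sub_one_le_of_reg335 i U hC h hq ⟨v, μ₂, μ₁, hlt⟩ hv h2 h1
    have e : plaqU (shiftsV1 (PV d ℓ i.m i.K hd hL)) U μ₁ μ₂ v = (holY i U ⟨v, μ₂, μ₁, hlt⟩)⁻¹ := B9Eq3117Current.plaqU_swap (shiftsV1 (PV d ℓ i.m i.K hd hL)) U μ₂ μ₁ v
    rw [e, B9Thm311PosOfPrincipalAtLettersY.norm_holY_inv_sub_one i U hUu]
    exact key

/-- ★★★ **THE BASE-BLOCK LASSOS ARE SMALL FOR A (3.35)-REGULAR BACKGROUND** (k-level index, `G ≤ U(N)`, `N ≥ 1`): `BaseLassoSmall i U (2(d+1)L²·ϖ(cMα₀))`.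
[cite: Balaban1985BackgroundPropagators, (3.40) p.397, (3.35) p.396, (3.69) p.404] -/
theorem lassoSmall_of_reg335 [Nonempty (Fin N)] {G : Subgroup (Matrix (Fin N) (Fin N) ℂ)ˣ} (hG : G ≤ B7Prop2Explicit.unitaryUnits (Matrix (Fin N) (Fin N) ℂ))
    {U : CfgY (Matrix (Fin N) (Fin N) ℂ) i} {c α₀ : ℝ} (h : (bg9K (Matrix (Fin N) (Fin N) ℂ) G i).Reg335 c α₀ U) :
    BaseLassoSmall i U (2 * ((d : ℝ) + 1) * (((ℓ + 1 : ℕ) : ℝ)) ^ 2 * varpi (c * (kGeo i).M * α₀)) := by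
  intro y z κ hz hzκ
  set Lr : ℝ := (((ℓ + 1 : ℕ) : ℝ)) with hLr
  have hL1 : (1 : ℝ) ≤ Lr := by rw [hLr]; exact_mod_cast Nat.succ_le_succ (Nat.zero_le ℓ)
  have hL0 : (0 : ℝ) < Lr := lt_of_lt_of_le one_pos hL1
  have hUL : ∀ μ w, UnitaryLike (U μ w) := fun μ w => B9Eq3132TentKinetic.contractive_of_mem (hG (h.1 μ w))
  -- split the directions at `κ`
  obtain ⟨l₁, l₂, hl⟩ := List.append_of_mem (List.mem_finRange κ)
  obtain ⟨hl1, hκ1, hl2, hκ2⟩ := split_nodup hl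
  -- box data
  have hx := orgY_mem_hullBox i y
  have hzB := baseBlk_subset_hullBox i y hz
  have hzκB := baseBlk_subset_hullBox i y hzκ
  have h2s := two_mul_hullSide_le i y
  -- no antipode on the `κ`-leg
  have hF : (z κ - (orgY i y) κ).val ≤ ((orgY i y) κ - z κ).val → 2 * ((z κ - (orgY i y) κ).val + 1) < (PV d ℓ i.m i.K hd hL).sitesPerDir 0 := by
    intro hreg
    have ha := fwd_count_lt (hx κ) (hzB κ) hreg
    have h4 := four_mul_side_lt i y
    have hs' := (hullSide_le i y κ).2
    omega
  -- the lasso through the later legs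
  have hW := norm_taxiLasso_sub_one_le hUL (orgY i y) z κ hl hF
  set yκ := legPt U (orgY i y) z κ l₁
  set ρ := taxiSteps l₂ yκ z
  have hyκ : ∀ μ, yκ μ = if μ ∈ l₂ then (orgY i y) μ else z μ := legPt_apply i U (orgY i y) z κ hl
  -- the class cube of the hull box
  obtain ⟨q, hq, hqj, hqmem⟩ := exists_cubeClass396_hullBox i y
  -- every corner of every swept plaquette lies in the hull box
  have hbox : ∀ v : Site (PV d ℓ i.m i.K hd hL) 0, (∀ μ, μ ∉ l₂ → v μ = yκ μ) → (∀ μ, μ ∈ l₂ → OnArc (yκ μ) (z μ) (v μ)) → v ∈ hullBox i y ∧ v.shift κ ∈ hullBox i y := by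
    intro v hoff hon
    have hv : ∀ μ, (v μ - cornerOf i (lvl i.hN i.D i.hk y) y.1.2.src μ).val < hullSide i y μ := by
      intro μ
      by_cases hμ : μ ∈ l₂
      · have := hon μ hμ
        rw [hyκ μ, if_pos hμ] at this
        exact onArc_mem_interval (h2s μ) (hx μ) (hzB μ) this
      · rw [hoff μ hμ, hyκ μ, if_neg hμ]; exact hzB μ
    refine ⟨hv, fun μ => ?_⟩
    by_cases hμκ : μ = κ
    · subst hμκ
      have e : (v.shift μ) μ = (z.shift μ) μ := by
        simp only [Site.shift, Function.update_self]
        rw [hoff μ hκ2, hyκ μ, if_neg hκ2]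
      rw [e]; exact hzκB μ
    · rw [B6Ineq2142KLevelV1.shift_apply_of_ne v hμκ]; exact hv μ
  -- the uniform plaquette bound along `ρ`
  set δ : ℝ := varpi (c * (kGeo i).M * α₀) * (Lr ^ q.2)⁻¹ ^ 2 with hδ
  have hrungs : ∀ r ∈ rungSites ρ yκ,
      ‖((plaqU (shiftsV1 (PV d ℓ i.m i.K hd hL)) U (if r.2.2 then r.2.1 else κ) (if r.2.2 then κ else r.2.1) r.1 : (Matrix (Fin N) (Fin N) ℂ)ˣ) : Matrix (Fin N) (Fin N) ℂ) - 1‖ ≤ δ := by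
    intro r hr
    obtain ⟨hdir, hoff, hon⟩ := rungSites_taxiSteps z l₂ hl2 yκ r hr
    have hνκ : r.2.1 ≠ κ := fun e => hκ2 (e ▸ hdir)
    obtain ⟨hv, hvκ⟩ := hbox r.1 (fun μ hμ => (hoff μ hμ).1) (fun μ hμ => (hon μ hμ).1)
    obtain ⟨hvν, -⟩ := hbox (r.1.shift r.2.1) (fun μ hμ => (hoff μ hμ).2) (fun μ hμ => (hon μ hμ).2)
    cases hb : r.2.2
    · simp only [Bool.false_eq_true, if_false]
      exact norm_plaqU_sub_one_le_of_mem i hG h hq hνκ.symm (hqmem _ hv) (hqmem _ hvκ) (hqmem _ hvν)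
    · simp only [if_true]
      exact norm_plaqU_sub_one_le_of_mem i hG h hq hνκ (hqmem _ hv) (hqmem _ hvν) (hqmem _ hvκ)
  have hdef := stepDefect_le_of_forall κ U ρ yκ hrungs
  -- the number of steps
  have hlen : ρ.length ≤ l₂.length * (2 * (ℓ + 1) ^ (lvl i.hN i.D i.hk y)) := by
    refine length_taxiSteps_le yκ z (fun ν => ?_) l₂
    rw [hyκ ν]
    by_cases hν : ν ∈ l₂
    · rw [if_pos hν]
      have := min_count_lt (hx ν) (hzB ν)
      have := (hullSide_le i y ν).2
      omega
    · rw [if_neg hν, sub_self, ZMod.val_zero]; simp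
  have hl2len : l₂.length ≤ d + 1 := by
    have e := congrArg List.length hl
    rw [List.length_finRange, List.length_append, List.length_cons] at e
    have : (PV d ℓ i.m i.K hd hL).d = d + 1 := rfl
    omega
  -- assemble
  have hδ0 : 0 ≤ δ := mul_nonneg (varpi_nonneg (reg335_const_pos i h).le) (sq_nonneg _)
  have hq1 : lvl i.hN i.D i.hk y ≤ q.2 + 1 := hqj
  have hpow : (Lr ^ q.2)⁻¹ ≤ Lr * (Lr ^ (lvl i.hN i.D i.hk y))⁻¹ := by
    rw [inv_le_comm₀ (pow_pos hL0 _) (mul_pos hL0 (inv_pos.2 (pow_pos hL0 _))), mul_inv, inv_inv]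
    calc Lr⁻¹ * Lr ^ (lvl i.hN i.D i.hk y) ≤ Lr⁻¹ * Lr ^ (q.2 + 1) := mul_le_mul_of_nonneg_left (pow_le_pow_right₀ hL1 hq1) (inv_nonneg.2 hL0.le)
      _ = Lr ^ q.2 := by rw [pow_succ]; field_simp
  have hpow' : (Lr ^ q.2)⁻¹ ^ 2 ≤ Lr ^ 2 * ((Lr ^ (lvl i.hN i.D i.hk y))⁻¹) ^ 2 := by
    have h0 : 0 ≤ (Lr ^ q.2)⁻¹ := inv_nonneg.2 (pow_nonneg hL0.le _)
    calc (Lr ^ q.2)⁻¹ ^ 2 ≤ (Lr * (Lr ^ (lvl i.hN i.D i.hk y))⁻¹) ^ 2 := pow_le_pow_left₀ h0 hpow 2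
      _ = Lr ^ 2 * ((Lr ^ (lvl i.hN i.D i.hk y))⁻¹) ^ 2 := by ring
  have hlenR : (ρ.length : ℝ) ≤ ((d : ℝ) + 1) * (2 * Lr ^ (lvl i.hN i.D i.hk y)) := by
    have h1 : (ρ.length : ℝ) ≤ (l₂.length : ℝ) * (2 * Lr ^ (lvl i.hN i.D i.hk y)) := by rw [hLr]; exact_mod_cast hlen
    have h2 : ((l₂.length : ℕ) : ℝ) ≤ (d : ℝ) + 1 := by exact_mod_cast hl2len
    nlinarith [pow_nonneg hL0.le (lvl i.hN i.D i.hk y)]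
  have hside : sideY i y = Lr ^ (lvl i.hN i.D i.hk y) := rfl
  rw [hside]
  have hLj : Lr ^ (lvl i.hN i.D i.hk y) ≠ 0 := pow_ne_zero _ hL0.ne'
  calc _ ≤ stepDefect κ U ρ yκ := hW
    _ ≤ ρ.length * δ := hdef
    _ ≤ (((d : ℝ) + 1) * (2 * Lr ^ (lvl i.hN i.D i.hk y))) * (varpi (c * (kGeo i).M * α₀) * (Lr ^ 2 * ((Lr ^ (lvl i.hN i.D i.hk y))⁻¹) ^ 2)) := by
        refine mul_le_mul hlenR (mul_le_mul_of_nonneg_left hpow' (varpi_nonneg (reg335_const_pos i h).le)) hδ0 (by positivity)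
    _ = 2 * ((d : ℝ) + 1) * Lr ^ 2 * varpi (c * (kGeo i).M * α₀) * (Lr ^ (lvl i.hN i.D i.hk y))⁻¹ *
          (Lr ^ (lvl i.hN i.D i.hk y) * (Lr ^ (lvl i.hN i.D i.hk y))⁻¹) := by ring
    _ = 2 * ((d : ℝ) + 1) * Lr ^ 2 * varpi (c * (kGeo i).M * α₀) * (Lr ^ (lvl i.hN i.D i.hk y))⁻¹ := by rw [mul_inv_cancel₀ hLj, mul_one]

/-! ## §2 ★★★ Row 26's binder `hP1`, discharged -/

/-- at `N = 0` every matrix vanishes, so the lassos are trivially small. [cite: Balaban1985BackgroundPropagators, (3.40) p.397, bookkeeping (degenerate fibre)] -/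
theorem baseLassoSmall_of_isEmpty [IsEmpty (Fin N)] (U : CfgY (Matrix (Fin N) (Fin N) ℂ) i) {ω : ℝ} (hω : 0 ≤ ω) : BaseLassoSmall i U ω := by
  intro y z κ _ _
  have h0 : ((parBY i U (orgY i y) z * U κ z * (parBY i U (orgY i y) (z.shift κ))⁻¹ : (Matrix (Fin N) (Fin N) ℂ)ˣ) : Matrix (Fin N) (Fin N) ℂ) - 1 = 0 :=
    Subsingleton.elim _ _
  rw [h0, norm_zero]
  exact mul_nonneg hω (inv_nonneg.2 (sideY_pos i y).le)

/-- (hW) is monotone in its constant. [cite: Balaban1985BackgroundPropagators, (3.40) p.397, bookkeeping] -/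
theorem baseLassoSmall_mono {U : CfgY (Matrix (Fin N) (Fin N) ℂ) i} {ω ω' : ℝ} (h : BaseLassoSmall i U ω) (hle : ω ≤ ω') : BaseLassoSmall i U ω' :=
  fun y z κ hz hzκ => (h y z κ hz hzκ).trans (mul_le_mul_of_nonneg_right hle (inv_nonneg.2 (sideY_pos i y).le))

/-- ★★★ **(hW) AT A MEMBER OF def-Y's RECORD, member-uniform**: below `M·α₀ ≤ aT` (`α₀ > 0`), every background in the member's class (3.35) has base-block lassos within
`2(d+1)L²ϖ(c·aT)·(Lʲ)⁻¹` of `1`. [cite: Balaban1985BackgroundPropagators, (3.35) p.396, (3.40) p.397] -/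
theorem lassoSmall_member_of_reg335 [Nonempty (Fin N)] {Mstar : ℕ} (x : MemberY d ℓ hd hL b₀ b₁ Mstar) {c α₀ aT : ℝ} (hα : 0 < α₀) (hMa : (geo9Y x).M * α₀ ≤ aT)
    {U : (bg9Y (Matrix (Fin N) (Fin N) ℂ) (specialUnitaryUnits (Fin N)) x).Cfg} (h : (bg9Y (Matrix (Fin N) (Fin N) ℂ) (specialUnitaryUnits (Fin N)) x).Reg335 c α₀ U) :
    BaseLassoSmall x.toKIdx U (2 * ((d : ℝ) + 1) * (((ℓ + 1 : ℕ) : ℝ)) ^ 2 * varpi (c * aT)) := by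
  have h1 := lassoSmall_of_reg335 x.toKIdx (specialUnitaryUnits_le_unitaryUnits (n := Fin N)) h.1
  have hpos := reg335_const_pos x.toKIdx h.1
  have hc : 0 < c := by
    have : 0 < c * ((kGeo x.toKIdx).M * α₀) := by rw [← mul_assoc]; exact hpos
    exact pos_of_mul_pos_left this (mul_pos (M_pos x.toKIdx) hα).le
  have hle : c * (kGeo x.toKIdx).M * α₀ ≤ c * aT := by rw [mul_assoc]; exact mul_le_mul_of_nonneg_left hMa hc.le
  exact baseLassoSmall_mono x.toKIdx h1 (mul_le_mul_of_nonneg_left (varpi_mono hpos.le hle) (by positivity))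

/-- ★★★ **ROW 26's BINDER `hP1`, DISCHARGED**: the `Δ_a(U)`-energy of the transported tent bumps is bounded by `C‖Ψ‖²`, uniformly over the members of def-Y's record and
over the (3.35)-regular `SU(N)`-valued backgrounds below `M·α₀ ≤ 1` — the statement displayed by `B9Eq3132CoerciveFromEnergy.hco26_of_energy_step12` (certificate ed. 12),
VERBATIM, with NO displayed hypothesis. [cite: Balaban1984PropagatorsII, (2.147) p.248; Balaban1985BackgroundPropagators, (3.132) p.422, (3.35) p.396, (3.69) p.404, (3.40) p.397] -/
theorem hP1_of_reg335 (θ : Stage3Params) (Mstar : ℕ) (c35 : ℝ) :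
    ∃ Mt aT C : ℝ, 0 < Mt ∧ 0 < aT ∧ 0 < C ∧
      ∀ x : MemberY θ.d₆ θ.ℓ₆ θ.hd' θ.hL' θ.b₀ θ.b₁ Mstar, Mt ≤ (geo9Y x).M → ∀ α₀ : ℝ, 0 < α₀ → (geo9Y x).M * α₀ ≤ aT →
        ∀ U : (bg9Y (Matrix (Fin N) (Fin N) ℂ) (specialUnitaryUnits (Fin N)) x).Cfg,
          (bg9Y (Matrix (Fin N) (Fin N) ℂ) (specialUnitaryUnits (Fin N)) x).Reg335 c35 α₀ U → (bg9Y (Matrix (Fin N) (Fin N) ℂ) (specialUnitaryUnits (Fin N)) x).Reg336 c35 α₀ U →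
            ∀ Ψ : IBondY x.toKIdx → Matrix (Fin N) (Fin N) ℂ,
              B9Thm311ReadingCoords.trIP (fun _ => (1 : ℝ)) (B9Eq3132TentOperator.tentOp x.toKIdx (B9Eq3132ApproxRightInverse.bumpProfile x.toKIdx) U Ψ)
                  (deltaAY x.toKIdx (parSymY x.toKIdx) (parBY x.toKIdx) (GpY x.toKIdx (parSymY x.toKIdx)) U
                    (B9Eq3132TentOperator.tentOp x.toKIdx (B9Eq3132ApproxRightInverse.bumpProfile x.toKIdx) U Ψ)) ≤
                C * B9Thm311ReadingCoords.trIP (fun _ => (1 : ℝ)) Ψ Ψ := by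
  refine B9Eq3132TentPlaquettes.hP1_of_lassoSmall θ Mstar
    ⟨1, 2 * ((θ.d₆ : ℝ) + 1) * (((θ.ℓ₆ + 1 : ℕ) : ℝ)) ^ 2 * varpi (|c35| * 1), one_pos, fun x α₀ hα hMa U h335 => ?_⟩
  rcases isEmpty_or_nonempty (Fin N) with hN | hN
  · exact baseLassoSmall_of_isEmpty x.toKIdx U (by have := varpi_nonneg (C := |c35| * 1) (by positivity); positivity)
  · have hpos := reg335_const_pos x.toKIdx h335.1
    have hc : 0 < c35 := by
      have : 0 < c35 * ((kGeo x.toKIdx).M * α₀) := by rw [← mul_assoc]; exact hpos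
      exact pos_of_mul_pos_left this (mul_pos (M_pos x.toKIdx) hα).le
    rw [show |c35| = c35 from abs_of_pos hc]
    exact lassoSmall_member_of_reg335 x hα hMa h335

end Literature.MathematicalPhysics.QuantumFieldTheory.Balaban1983to89.B9Eq3132TentLassos

end
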